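import Summits.BirchSwinnertonDyer.BirchSwinnertonDyer.Theorems.ResidualThetaTransportAtTwoThetaLayerLambdaCongruenceAtTwoIpOfTransposeAdjoint
import HarnessLib

/-!
# Crux Kan⁺ `ThetaLayerLambdaCongruenceAtTwo` (stmt-BirchSwinnertonDyer-20688), line `birth` v14, SD floor, Hecke clause — brick «H1x»:
# the Hecke operators `T_p` and `T♯_p = [Γ₀(N) diag(p,1) Γ₀(N)]` ON PERIOD FUNCTIONALS with EXPLICIT CUSPS (instantiation layer of HA8)
# (width seat bsd-wall-rtt-p3-w4 g7; `--supports stmt-BirchSwinnertonDyer-20688`; THEOREMS ONLY — no `def`, no named fact, no `sorry`)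

HONEST FRAMING. Elementary THEOREMS about the tree's `cuspSymbol` / `periodFunctional` / `periodHomologyHecke`; nothing about any curve
is asserted; nothing here settles Kan⁺; BSD is not proved by any of this.

WHY. The Hecke clause HA of IP (`Lines/birth-sd2-hecke-adjoint.md`, rtt-p3-w3 g11) is proved on period functionals `x = {∞, γ∞}`,
`y = {∞, γ'∞}` (every element of `Λ` is one, `coe_periodHomology_eq_range`) and needs, as its FIRST line, the action of `T_p` on
`{∞, γ∞}` as an explicit sum `Σ_j {∞, δ_j∞} + [p ∤ N] {∞, δ'∞}` with the `δ`'s GIVEN BY THE HECKE COCYCLE `M γ = δ_M M_{σ(M)}` of the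
representatives `R_p = {M_j = (1 j; 0 p)} ∪ [p ∤ N] {diag(p,1)}` (memo §2 (H1)). The tree's `exists_dualMap_heckeT_periodFunctional` HIDES
the `δ`'s under a bare `∃`. This file states the formula for ANY `δ`'s with the right CUSPS — `δ_j∞ = M_jγ∞ = (γ∞ + j)/p`, `δ'∞ = pγ∞` —
written as INTEGER cross-multiplied conditions on first columns (so a cocycle user discharges them by `ring`: from `M_j γ = δ M_{j'}` one
reads `δ₀₀ = a + jc, δ₁₀ = pc`; from `M_j γ = δ diag(p,1)`: `pδ₀₀ = a + jc, δ₁₀ = c`; from `diag(p,1) γ = δ' M_{j'}`: `δ'₀₀ = pa, δ'₁₀ = c`;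
from `diag(p,1) γ = δ' diag(p,1)`: `δ'₀₀ = a, pδ'₁₀ = c`), lifts it to `Λ = periodHomologyHecke N` (`HeckeRing0.T N 2 p hp • ⟨{∞,γ∞}, _⟩`),
and gives the TRANSPOSED operator `T♯_p` on `{∞, γ∞}` through the Fricke conjugates (`T♯_p = w T_p w`, `…IpOfTransposeAdjoint` §1, +
rtt-p3-w4 g6's `dualMap_frickeInvolution_periodFunctional`). Finally `exists_perfect_balanced_of_transposeAdjoint_periodFunctional`:
the transpose-adjointness hypothesis of `exists_perfect_balanced_of_transposeAdjoint` need only be checked on period functionals.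

References: J. E. Cremona, Algorithms for modular elliptic curves (1997) §2.4 (2.4.1)–(2.4.2) [CremonaAlgorithms1997]; L. Merel (1995)
§2.1–2.3 [Merel1995Homologie]; F. Diamond, J. Shurman (2005) Ex. 5.5.1 [DiamondShurman2005].
-/

set_option autoImplicit false
-- justification: the `Summit.BirchSwinnertonDyer.BirchSwinnertonDyer.…` path repeats a component (route-file convention)
set_option linter.dupNamespace false

noncomputable section

open scoped MatrixGroups ModularForm

open CongruenceSubgroup Matrix.SpecialLinearGroup ModularGroup
open Literature.NumberTheory.EllipticCurves Literature.NumberTheory.EllipticCurves.ModularForms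

namespace Summit.BirchSwinnertonDyer.BirchSwinnertonDyer.Theorems.ThetaLayerLambdaCongruenceAtTwo

section HeckeOnPeriods

variable (N : ℕ) [NeZero N] {p : ℕ} (hp : p.Prime)
include hp

/-- **`{∞, γ∞}_{T_p h} = Σ_j {∞, δ_j∞}_h + [p ∤ N] {∞, δ'∞}_h` for ANY `δ_j, δ' ∈ Γ₀(N)` with the cusps `δ_j∞ = (γ∞ + j)/p`,
`δ'∞ = p·γ∞`** (cusps as integer cross-multiplied first-column conditions; `γ∞ = ∞` iff `γ₁₀ = 0`, and then all terms vanish).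
The tree's `exists_cuspSymbol_heckeT` with the `δ`'s universally quantified (Cremona §2.4 (2.4.2): `⟨T_p{α,β}, h⟩ = ⟨{α,β}, T_p h⟩`).
[cite: CremonaAlgorithms1997, §2.4 (2.4.1)–(2.4.2)] -/
theorem cuspSymbol_heckeT_eq_sum_of_cusps (γ : Gamma0 N) (δ : Fin p → Gamma0 N) (δ' : Gamma0 N)
    (hδ0 : ∀ j : Fin p, ((δ j : SL(2, ℤ)) 1 0 = 0 ↔ (γ : SL(2, ℤ)) 1 0 = 0))
    (hδ : ∀ j : Fin p, (δ j : SL(2, ℤ)) 0 0 * ((p : ℤ) * (γ : SL(2, ℤ)) 1 0) =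
      (δ j : SL(2, ℤ)) 1 0 * ((γ : SL(2, ℤ)) 0 0 + ((j : ℕ) : ℤ) * (γ : SL(2, ℤ)) 1 0))
    (hδ'0 : ¬ p ∣ N → (((δ' : SL(2, ℤ)) 1 0 = 0 ↔ (γ : SL(2, ℤ)) 1 0 = 0)))
    (hδ' : ¬ p ∣ N → (δ' : SL(2, ℤ)) 0 0 * (γ : SL(2, ℤ)) 1 0 = (δ' : SL(2, ℤ)) 1 0 * ((p : ℤ) * (γ : SL(2, ℤ)) 0 0))
    (h : CuspForm (Gamma0 N) 2) :
    cuspSymbol (haveI : NeZero p := ⟨hp.ne_zero⟩; heckeT (Gamma0 N) 2 p h) γ =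
      ∑ j : Fin p, cuspSymbol h (δ j) + if p ∣ N then 0 else cuspSymbol h δ' := by
  haveI : NeZero p := ⟨hp.ne_zero⟩
  have hp0 : (p : ℚ) ≠ 0 := Nat.cast_ne_zero.mpr hp.ne_zero
  by_cases hc : (γ : SL(2, ℤ)) 1 0 = 0
  · -- `γ∞ = ∞`: every term vanishes
    rw [cuspSymbol, if_pos hc, Finset.sum_eq_zero (fun j _ ↦ by rw [cuspSymbol, if_pos ((hδ0 j).mpr hc)]), zero_add]
    split_ifs with hpN
    · rfl
    · rw [cuspSymbol, if_pos ((hδ'0 hpN).mpr hc)]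
  · have hcQ : ((γ : SL(2, ℤ)) 1 0 : ℚ) ≠ 0 := Int.cast_ne_zero.mpr hc
    have key : ∀ j : Fin p,
        modularSymbol h (((((γ : SL(2, ℤ)) 0 0 : ℚ) / ((γ : SL(2, ℤ)) 1 0 : ℚ)) + ((j : ℕ) : ℤ)) / p) =
          cuspSymbol h (δ j) := by
      intro j
      have hδc : ((δ j : SL(2, ℤ)) 1 0 : ℚ) ≠ 0 := Int.cast_ne_zero.mpr (fun h0 ↦ hc ((hδ0 j).mp h0))
      have e : (((δ j : SL(2, ℤ)) 0 0 : ℤ) : ℚ) * ((p : ℚ) * ((γ : SL(2, ℤ)) 1 0 : ℚ)) =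
          (((δ j : SL(2, ℤ)) 1 0 : ℤ) : ℚ) * (((γ : SL(2, ℤ)) 0 0 : ℚ) + (((j : ℕ) : ℤ) : ℚ) * ((γ : SL(2, ℤ)) 1 0 : ℚ)) := by
        exact_mod_cast hδ j
      rw [cuspSymbol, if_neg (fun h0 ↦ hc ((hδ0 j).mp h0))]
      congr 1
      rw [div_add' _ _ _ hcQ, div_div, div_eq_div_iff (mul_ne_zero hcQ hp0) hδc]
      linear_combination -e
    by_cases hpN : p ∣ N
    · rw [cuspSymbol, if_neg hc, modularSymbol_heckeT_eq_sum p h hp, if_pos hpN, if_pos hpN, add_zero, add_zero]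
      exact Finset.sum_congr rfl fun j _ ↦ key j
    · have hδ'c : ((δ' : SL(2, ℤ)) 1 0 : ℚ) ≠ 0 := Int.cast_ne_zero.mpr (fun h0 ↦ hc ((hδ'0 hpN).mp h0))
      have e' : (((δ' : SL(2, ℤ)) 0 0 : ℤ) : ℚ) * ((γ : SL(2, ℤ)) 1 0 : ℚ) =
          (((δ' : SL(2, ℤ)) 1 0 : ℤ) : ℚ) * ((p : ℚ) * ((γ : SL(2, ℤ)) 0 0 : ℚ)) := by
        exact_mod_cast hδ' hpN
      rw [cuspSymbol, if_neg hc, modularSymbol_heckeT_eq_sum p h hp, if_neg hpN, if_neg hpN,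
        Finset.sum_congr rfl fun j _ ↦ key j, cuspSymbol, if_neg (fun h0 ↦ hc ((hδ'0 hpN).mp h0))]
      congr 2
      rw [mul_div_assoc', div_eq_div_iff hcQ hδ'c]
      linear_combination -e'

/-- **`T_p^∨ {∞, γ∞} = Σ_j {∞, δ_j∞} + [p ∤ N] {∞, δ'∞}` on `S₂(Γ₀(N))^∨` for ANY `δ`'s with the cusps `(γ∞ + j)/p`, `pγ∞`** — the
tree's `exists_dualMap_heckeT_periodFunctional` with the `δ`'s universal (any Hecke cocycle qualifies, see the module docstring).
[cite: CremonaAlgorithms1997, §2.4 (2.4.1)–(2.4.2)] -/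
theorem dualMap_heckeT_periodFunctional_eq_sum_of_cusps (γ : Gamma0 N) (δ : Fin p → Gamma0 N) (δ' : Gamma0 N)
    (hδ0 : ∀ j : Fin p, ((δ j : SL(2, ℤ)) 1 0 = 0 ↔ (γ : SL(2, ℤ)) 1 0 = 0))
    (hδ : ∀ j : Fin p, (δ j : SL(2, ℤ)) 0 0 * ((p : ℤ) * (γ : SL(2, ℤ)) 1 0) =
      (δ j : SL(2, ℤ)) 1 0 * ((γ : SL(2, ℤ)) 0 0 + ((j : ℕ) : ℤ) * (γ : SL(2, ℤ)) 1 0))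
    (hδ'0 : ¬ p ∣ N → (((δ' : SL(2, ℤ)) 1 0 = 0 ↔ (γ : SL(2, ℤ)) 1 0 = 0)))
    (hδ' : ¬ p ∣ N → (δ' : SL(2, ℤ)) 0 0 * (γ : SL(2, ℤ)) 1 0 = (δ' : SL(2, ℤ)) 1 0 * ((p : ℤ) * (γ : SL(2, ℤ)) 0 0)) :
    (haveI : NeZero p := ⟨hp.ne_zero⟩; (heckeT (Gamma0 N) 2 p).dualMap (periodFunctional N γ)) =
      ∑ j : Fin p, periodFunctional N (δ j) + if p ∣ N then 0 else periodFunctional N δ' := by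
  haveI : NeZero p := ⟨hp.ne_zero⟩
  ext h
  rw [LinearMap.dualMap_apply, periodFunctional_apply, cuspSymbol_heckeT_eq_sum_of_cusps N hp γ δ δ' hδ0 hδ hδ'0 hδ' h]
  split_ifs <;> simp

/-- **`T_p • ⟨{∞, γ∞}⟩ = Σ_j ⟨{∞, δ_j∞}⟩ + [p ∤ N] ⟨{∞, δ'∞}⟩` in `Λ = periodHomologyHecke N`** (`T_p = HeckeRing0.T N 2 p`, the dual action)
for ANY `δ`'s with the cusps `(γ∞ + j)/p`, `pγ∞` — the first line of the Hecke-clause computation `B (T_p • x) y = Σ_j B ⟨{∞,δ_j∞}⟩ y + …`.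
[cite: CremonaAlgorithms1997, §2.4 (2.4.1)–(2.4.2)] [cite: DarmonDiamondTaylor1995, §1.6 (p. 41)] -/
theorem heckeT_smul_periodFunctional_eq_sum_of_cusps (γ : Gamma0 N) (δ : Fin p → Gamma0 N) (δ' : Gamma0 N)
    (hδ0 : ∀ j : Fin p, ((δ j : SL(2, ℤ)) 1 0 = 0 ↔ (γ : SL(2, ℤ)) 1 0 = 0))
    (hδ : ∀ j : Fin p, (δ j : SL(2, ℤ)) 0 0 * ((p : ℤ) * (γ : SL(2, ℤ)) 1 0) =
      (δ j : SL(2, ℤ)) 1 0 * ((γ : SL(2, ℤ)) 0 0 + ((j : ℕ) : ℤ) * (γ : SL(2, ℤ)) 1 0))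
    (hδ'0 : ¬ p ∣ N → (((δ' : SL(2, ℤ)) 1 0 = 0 ↔ (γ : SL(2, ℤ)) 1 0 = 0)))
    (hδ' : ¬ p ∣ N → (δ' : SL(2, ℤ)) 0 0 * (γ : SL(2, ℤ)) 1 0 = (δ' : SL(2, ℤ)) 1 0 * ((p : ℤ) * (γ : SL(2, ℤ)) 0 0)) :
    HeckeRing0.T N 2 p hp • (⟨periodFunctional N γ, periodFunctional_mem_periodHomology N γ⟩ : periodHomologyHecke N) =
      ∑ j : Fin p, (⟨periodFunctional N (δ j), periodFunctional_mem_periodHomology N (δ j)⟩ : periodHomologyHecke N) +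
        if p ∣ N then 0 else ⟨periodFunctional N δ', periodFunctional_mem_periodHomology N δ'⟩ := by
  haveI : NeZero p := ⟨hp.ne_zero⟩
  apply Subtype.ext
  rw [Submodule.coe_smul, SdTorsion.heckeRing0_T_smul_eq_dualMap,
    dualMap_heckeT_periodFunctional_eq_sum_of_cusps N hp γ δ δ' hδ0 hδ hδ'0 hδ', Submodule.coe_add, Submodule.coe_sum]
  split_ifs <;> simp

/-- **The transposed operator on period functionals through the Fricke conjugates**:
`T♯_p^∨ {∞, γ∞} = Σ_j {∞, ε_j∞} + [p ∤ N] {∞, ε'∞}`, where `γʷ` is a Fricke conjugate of `γ` (`w_N γ = γʷ w_N` on `ℍ`), the `δ`'s have the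
cusps `(γʷ∞ + j)/p`, `p γʷ∞`, and `ε_j`, `ε'` are Fricke conjugates of `δ_j`, `δ'` (`T♯_p^∨ = w^∨ T_p^∨ w^∨`, `dualMap_transposeHeckeT_eq_frickeConj`;
`w^∨ {∞, γ∞} = {∞, γʷ∞}`, `dualMap_frickeInvolution_periodFunctional`). [cite: DiamondShurman2005, Ex. 5.5.1] [cite: Merel1995Homologie, §2.3] -/
theorem dualMap_transposeHeckeT_periodFunctional_eq_sum (γ γw : Gamma0 N)
    (hconj : ∀ τ : UpperHalfPlane, glCast (frickeGL N : GL (Fin 2) ℚ) • ((γ : SL(2, ℤ)) • τ) =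
      (γw : SL(2, ℤ)) • (glCast (frickeGL N : GL (Fin 2) ℚ) • τ))
    (δ : Fin p → Gamma0 N) (δ' : Gamma0 N)
    (hδ0 : ∀ j : Fin p, ((δ j : SL(2, ℤ)) 1 0 = 0 ↔ (γw : SL(2, ℤ)) 1 0 = 0))
    (hδ : ∀ j : Fin p, (δ j : SL(2, ℤ)) 0 0 * ((p : ℤ) * (γw : SL(2, ℤ)) 1 0) =
      (δ j : SL(2, ℤ)) 1 0 * ((γw : SL(2, ℤ)) 0 0 + ((j : ℕ) : ℤ) * (γw : SL(2, ℤ)) 1 0))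
    (hδ'0 : ¬ p ∣ N → (((δ' : SL(2, ℤ)) 1 0 = 0 ↔ (γw : SL(2, ℤ)) 1 0 = 0)))
    (hδ' : ¬ p ∣ N → (δ' : SL(2, ℤ)) 0 0 * (γw : SL(2, ℤ)) 1 0 = (δ' : SL(2, ℤ)) 1 0 * ((p : ℤ) * (γw : SL(2, ℤ)) 0 0))
    (ε : Fin p → Gamma0 N) (ε' : Gamma0 N)
    (hε : ∀ (j : Fin p) (τ : UpperHalfPlane), glCast (frickeGL N : GL (Fin 2) ℚ) • ((δ j : SL(2, ℤ)) • τ) =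
      (ε j : SL(2, ℤ)) • (glCast (frickeGL N : GL (Fin 2) ℚ) • τ))
    (hε' : ¬ p ∣ N → ∀ τ : UpperHalfPlane, glCast (frickeGL N : GL (Fin 2) ℚ) • ((δ' : SL(2, ℤ)) • τ) =
      (ε' : SL(2, ℤ)) • (glCast (frickeGL N : GL (Fin 2) ℚ) • τ)) :
    (haveI : NeZero p := ⟨hp.ne_zero⟩;
      (cuspHeckeOperatorₗ (Gamma0 N) 2 (diagGL p 1 (Nat.cast_pos.mpr (NeZero.pos p)) one_pos)).dualMap (periodFunctional N γ)) =
      ∑ j : Fin p, periodFunctional N (ε j) + if p ∣ N then 0 else periodFunctional N ε' := by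
  haveI : NeZero p := ⟨hp.ne_zero⟩
  rw [dualMap_transposeHeckeT_eq_frickeConj, SdTorsion.dualMap_frickeInvolution_periodFunctional N γ γw hconj,
    dualMap_heckeT_periodFunctional_eq_sum_of_cusps N hp γw δ δ' hδ0 hδ hδ'0 hδ', map_add, map_sum]
  congr 1
  · exact Finset.sum_congr rfl fun j _ ↦ SdTorsion.dualMap_frickeInvolution_periodFunctional N (δ j) (ε j) (hε j)
  · split_ifs with hpN
    · exact map_zero _
    · exact SdTorsion.dualMap_frickeInvolution_periodFunctional N δ' ε' (hε' hpN)

omit hp in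
/-- **Cusp of a Hecke cocycle (upper-triangular representatives).** If `M γ = δ M_σ` with integer matrices `M`, `M_σ` fixing `∞`
(`M₁₀ = 0 = M_σ,₁₀`, `M_σ,₀₀ ≠ 0`) — the Hecke cocycle at `∞` in the shape `hcoc` of rtt-p3-w2 g8's `flatMap_reexpansion_isManinChain` — then
the first column of `δ` is parallel to that of `M γ`: `δ∞ = Mγ∞`, as integer cross-multiplied conditions. [cite: CremonaAlgorithms1997, §2.4] -/
theorem cusp_of_upperTriangular_cocycle {γ δ : SL(2, ℤ)} {M Mσ : Matrix (Fin 2) (Fin 2) ℤ}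
    (hM10 : M 1 0 = 0) (hMσ10 : Mσ 1 0 = 0) (hMσ00 : Mσ 0 0 ≠ 0)
    (hcoc : M * (γ : Matrix (Fin 2) (Fin 2) ℤ) = (δ : Matrix (Fin 2) (Fin 2) ℤ) * Mσ) :
    (δ 1 0 = 0 ↔ M 1 1 * γ 1 0 = 0) ∧ δ 1 0 * (M 0 0 * γ 0 0 + M 0 1 * γ 1 0) = δ 0 0 * (M 1 1 * γ 1 0) := by
  have e00 := congrFun (congrFun hcoc 0) 0
  have e10 := congrFun (congrFun hcoc 1) 0
  simp only [Matrix.mul_apply, Fin.sum_univ_two, hM10, hMσ10, zero_mul, zero_add, mul_zero, add_zero] at e00 e10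
  -- `e00 : M₀₀γ₀₀ + M₀₁γ₁₀ = δ₀₀ Mσ₀₀`, `e10 : M₁₁γ₁₀ = δ₁₀ Mσ₀₀`
  refine ⟨⟨fun h ↦ by rw [e10, h, zero_mul], fun h ↦ ?_⟩, ?_⟩
  · have : (δ : Matrix (Fin 2) (Fin 2) ℤ) 1 0 * Mσ 0 0 = 0 := by rw [← e10, h]
    exact (mul_eq_zero.mp this).resolve_right hMσ00
  · linear_combination (δ : Matrix (Fin 2) (Fin 2) ℤ) 1 0 * e00 - (δ : Matrix (Fin 2) (Fin 2) ℤ) 0 0 * e10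

/-- **Cusps of the cocycle of `M_j = (1 j; 0 p)`**: `M_j γ = δ M_σ` (`M_σ` upper-triangular, `M_σ,₀₀ ≠ 0`) gives EXACTLY the hypotheses
`hδ0`, `hδ` of `cuspSymbol_heckeT_eq_sum_of_cusps` for the index `j`. [cite: CremonaAlgorithms1997, §2.4] -/
theorem cusps_of_cocycle_tpB {γ δ : SL(2, ℤ)} {Mσ : Matrix (Fin 2) (Fin 2) ℤ} (j : ℤ)
    (hMσ10 : Mσ 1 0 = 0) (hMσ00 : Mσ 0 0 ≠ 0)
    (hcoc : !![(1 : ℤ), j; 0, (p : ℤ)] * (γ : Matrix (Fin 2) (Fin 2) ℤ) = (δ : Matrix (Fin 2) (Fin 2) ℤ) * Mσ) :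
    (δ 1 0 = 0 ↔ γ 1 0 = 0) ∧ δ 0 0 * ((p : ℤ) * γ 1 0) = δ 1 0 * (γ 0 0 + j * γ 1 0) := by
  have hpz : (p : ℤ) ≠ 0 := by exact_mod_cast hp.ne_zero
  obtain ⟨h0, h1⟩ := cusp_of_upperTriangular_cocycle (M := !![(1 : ℤ), j; 0, (p : ℤ)]) rfl hMσ10 hMσ00 hcoc
  simp only [Matrix.of_apply, Matrix.cons_val', Matrix.cons_val_zero, Matrix.cons_val_one, Matrix.cons_val_fin_one,
    one_mul] at h0 h1
  exact ⟨h0.trans (mul_eq_zero.trans (or_iff_right hpz)), h1.symm⟩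

omit hp in
/-- **Cusps of the cocycle of `diag(p,1)`** (`p ∤ N`): `diag(p,1) γ = δ' M_σ` gives EXACTLY the hypotheses `hδ'0`, `hδ'` of
`cuspSymbol_heckeT_eq_sum_of_cusps`. [cite: CremonaAlgorithms1997, §2.4] -/
theorem cusps_of_cocycle_tpD {γ δ : SL(2, ℤ)} {Mσ : Matrix (Fin 2) (Fin 2) ℤ}
    (hMσ10 : Mσ 1 0 = 0) (hMσ00 : Mσ 0 0 ≠ 0)
    (hcoc : !![(p : ℤ), 0; 0, 1] * (γ : Matrix (Fin 2) (Fin 2) ℤ) = (δ : Matrix (Fin 2) (Fin 2) ℤ) * Mσ) :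
    (δ 1 0 = 0 ↔ γ 1 0 = 0) ∧ δ 0 0 * γ 1 0 = δ 1 0 * ((p : ℤ) * γ 0 0) := by
  obtain ⟨h0, h1⟩ := cusp_of_upperTriangular_cocycle (M := !![(p : ℤ), 0; 0, 1]) rfl hMσ10 hMσ00 hcoc
  simp only [Matrix.of_apply, Matrix.cons_val', Matrix.cons_val_zero, Matrix.cons_val_one, Matrix.cons_val_fin_one,
    one_mul, zero_mul, add_zero] at h0 h1
  exact ⟨h0, h1.symm⟩

omit hp in
/-- **The Fricke conjugate with EXPLICIT entries**: for `γ = (a b; c d) ∈ Γ₀(N)` the element `γʷ = (d, -c/N; -Nb, a) ∈ Γ₀(N)` satisfies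
`w_N ∘ γ = γʷ ∘ w_N` on `ℍ` (the tree's `frickeGL_mul_mul_inv_mem` / rtt-p3-w4 g6's `exists_frickeConj_smul`, with the matrix exposed so
that Manin / dual chains of Fricke conjugates can be written down). [cite: AtkinLehner1970, §2] -/
theorem exists_frickeConj_explicit (γ : Gamma0 N) :
    ∃ γ' : Gamma0 N,
      (∀ τ : UpperHalfPlane, glCast (frickeGL N : GL (Fin 2) ℚ) • ((γ : SL(2, ℤ)) • τ) =
        (γ' : SL(2, ℤ)) • (glCast (frickeGL N : GL (Fin 2) ℚ) • τ)) ∧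
      (γ' : SL(2, ℤ)) 0 0 = (γ : SL(2, ℤ)) 1 1 ∧ (N : ℤ) * (γ' : SL(2, ℤ)) 0 1 = -((γ : SL(2, ℤ)) 1 0) ∧
      (γ' : SL(2, ℤ)) 1 0 = -((N : ℤ) * (γ : SL(2, ℤ)) 0 1) ∧ (γ' : SL(2, ℤ)) 1 1 = (γ : SL(2, ℤ)) 0 0 := by
  have h10 : ((((γ : SL(2, ℤ)) 1 0 : ℤ)) : ZMod N) = 0 := Gamma0_mem.mp γ.2
  obtain ⟨c', hc'⟩ := (ZMod.intCast_zmod_eq_zero_iff_dvd _ N).mp h10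
  have hdet : Matrix.det !![(γ : SL(2, ℤ)) 1 1, -c'; -((N : ℤ) * (γ : SL(2, ℤ)) 0 1), (γ : SL(2, ℤ)) 0 0] = 1 := by
    have h := Matrix.SpecialLinearGroup.det_coe (γ : SL(2, ℤ))
    rw [Matrix.det_fin_two, hc'] at h
    rw [Matrix.det_fin_two_of]
    linear_combination h
  let δ : SL(2, ℤ) := ⟨!![(γ : SL(2, ℤ)) 1 1, -c'; -((N : ℤ) * (γ : SL(2, ℤ)) 0 1), (γ : SL(2, ℤ)) 0 0], hdet⟩
  have hδ : δ ∈ Gamma0 N := Gamma0_mem.mpr (by simp [δ])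
  have hmat : Matrix.SpecialLinearGroup.mapGL ℝ δ * glCast (frickeGL N : GL (Fin 2) ℚ) =
      glCast (frickeGL N : GL (Fin 2) ℚ) * Matrix.SpecialLinearGroup.mapGL ℝ (γ : SL(2, ℤ)) := by
    refine Units.ext ?_
    have hc'' : (((γ : SL(2, ℤ)) 1 0 : ℤ) : ℝ) = N * c' := by exact_mod_cast hc'
    rw [Matrix.GeneralLinearGroup.coe_mul, Matrix.GeneralLinearGroup.coe_mul, val_glCast_frickeGL,
      mapGL_coe_matrix, mapGL_coe_matrix]
    ext i j
    fin_cases i <;> fin_cases j <;> simp [δ, Matrix.mul_apply, Fin.sum_univ_two, hc''] <;> ring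
  refine ⟨⟨δ, hδ⟩, fun τ ↦ ?_, rfl, ?_, rfl, rfl⟩
  · have h1 : ((⟨δ, hδ⟩ : Gamma0 N) : SL(2, ℤ)) • (glCast (frickeGL N : GL (Fin 2) ℚ) • τ) =
        Matrix.SpecialLinearGroup.mapGL ℝ δ • (glCast (frickeGL N : GL (Fin 2) ℚ) • τ) := rfl
    have h2 : (γ : SL(2, ℤ)) • τ = Matrix.SpecialLinearGroup.mapGL ℝ (γ : SL(2, ℤ)) • τ := rfl
    rw [h1, h2, ← mul_smul, ← mul_smul, hmat]
  · show (N : ℤ) * (-c') = -((γ : SL(2, ℤ)) 1 0)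
    rw [hc']
    ring

omit hp in
/-- **`w_N^∨ {∞, γ∞} = {∞, γʷ∞}` with the Fricke conjugate `γʷ = (d, -c/N; -Nb, a)` EXPLICIT** (`dualMap_frickeInvolution_periodFunctional` of
rtt-p3-w4 g6 + `exists_frickeConj_explicit`). [cite: Merel1995Homologie, §2.3] [cite: AtkinLehner1970, §2] -/
theorem exists_dualMap_frickeInvolution_periodFunctional_explicit (γ : Gamma0 N) :
    ∃ γ' : Gamma0 N,
      (frickeInvolution N 2).dualMap (periodFunctional N γ) = periodFunctional N γ' ∧
      (γ' : SL(2, ℤ)) 0 0 = (γ : SL(2, ℤ)) 1 1 ∧ (N : ℤ) * (γ' : SL(2, ℤ)) 0 1 = -((γ : SL(2, ℤ)) 1 0) ∧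
      (γ' : SL(2, ℤ)) 1 0 = -((N : ℤ) * (γ : SL(2, ℤ)) 0 1) ∧ (γ' : SL(2, ℤ)) 1 1 = (γ : SL(2, ℤ)) 0 0 := by
  obtain ⟨γ', hconj, h00, h01, h10, h11⟩ := exists_frickeConj_explicit N γ
  exact ⟨γ', SdTorsion.dualMap_frickeInvolution_periodFunctional N γ γ' hconj, h00, h01, h10, h11⟩

omit hp in
/-- **Transpose-adjointness need only be checked on period functionals.** If for every prime `p`, all `γ, γ' ∈ Γ₀(N)` and every
`y' ∈ Λ` whose underlying functional is `T♯_p^∨ {∞, γ'∞}` one has `B (T_p • ⟨{∞,γ∞}⟩) ⟨{∞,γ'∞}⟩ = B ⟨{∞,γ∞}⟩ y'`, then (every element of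
`Λ` being a single period functional, `coe_periodHomology_eq_range`) the hypothesis of `exists_perfect_balanced_of_transposeAdjoint` holds, so a
bijective such `B` gives IP at level `N`. [cite: CremonaAlgorithms1997, Lemma 2.1.1] [cite: Merel1995Homologie, §2.1–2.3] -/
theorem exists_perfect_balanced_of_transposeAdjoint_periodFunctional
    (B : periodHomologyHecke N →+ (periodHomologyHecke N →+ ℤ)) (hB : Function.Bijective B)
    (hAdj : ∀ (p : ℕ) (hp : p.Prime) (γ γ' : Gamma0 N) (y' : periodHomologyHecke N),
      ((y' : periodHomologyHecke N) : Module.Dual ℂ (CuspForm (Gamma0 N) 2)) =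
        (haveI : NeZero p := ⟨hp.ne_zero⟩;
          (cuspHeckeOperatorₗ (Gamma0 N) 2 (diagGL p 1 (Nat.cast_pos.mpr (NeZero.pos p)) one_pos)).dualMap
            (periodFunctional N γ')) →
      B (HeckeRing0.T N 2 p hp • ⟨periodFunctional N γ, periodFunctional_mem_periodHomology N γ⟩)
          ⟨periodFunctional N γ', periodFunctional_mem_periodHomology N γ'⟩ =
        B ⟨periodFunctional N γ, periodFunctional_mem_periodHomology N γ⟩ y') :
    ∃ B' : periodHomologyHecke N →+ (periodHomologyHecke N →+ ℤ),
      Function.Bijective B' ∧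
        ∀ (t : HeckeRing0 N 2) (x y : periodHomologyHecke N), B' (t • x) y = B' x (t • y) := by
  refine exists_perfect_balanced_of_transposeAdjoint B hB fun p hp x y y' hy' ↦ ?_
  have hx : (x : Module.Dual ℂ (CuspForm (Gamma0 N) 2)) ∈ (periodHomology N : Set (Module.Dual ℂ (CuspForm (Gamma0 N) 2))) :=
    (mem_periodHomologyHecke N).mp x.2
  have hy : (y : Module.Dual ℂ (CuspForm (Gamma0 N) 2)) ∈ (periodHomology N : Set (Module.Dual ℂ (CuspForm (Gamma0 N) 2))) :=
    (mem_periodHomologyHecke N).mp y.2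
  rw [coe_periodHomology_eq_range] at hx hy
  obtain ⟨γ, hγ⟩ := hx
  obtain ⟨γ', hγ'⟩ := hy
  have ex : x = ⟨periodFunctional N γ, periodFunctional_mem_periodHomology N γ⟩ := Subtype.ext hγ.symm
  have ey : y = ⟨periodFunctional N γ', periodFunctional_mem_periodHomology N γ'⟩ := Subtype.ext hγ'.symm
  subst ex ey
  exact hAdj p hp γ γ' y' hy'

end HeckeOnPeriods

end Summit.BirchSwinnertonDyer.BirchSwinnertonDyer.Theorems.ThetaLayerLambdaCongruenceAtTwo

end
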